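import Summits.BirchSwinnertonDyer.Rank1Residual.X12.ClassClosureO10Readings
import Summits.BirchSwinnertonDyer.Rank1Residual.X12.CMTamagawaThreeAll
import HarnessLib

/-!
# Route `InertBadSignedBranches` (rung K8), residual crux `InertBadAtThree` — file 2/4: the pair-level
# LOWER HALF at ANY ODD prime, law-agnostic (seat bsd-cm-inert g10; helper lemmas, nothing asserted)

The landed O10-PS chain (`X12/ClassClosureO10Readings.lean`, p402929; x1b's
`Additive/QuadraticBranchLowerHalfOfReadings.lean`) carries `hp5 : 5 ≤ p` for exactly three reasons:
(i) `p ≠ 2`; (ii) `ord_p c_p(W) = 0` by Kodaira–Néron (`c_p ≤ 4 < p`); (iii) the typed law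
`Additive.QuadraticBranchMinusLeadingValuationAt W p 0` (C-cc-1) has `5 ≤ p →` inside its body, so it
can only be USED at `p ≥ 5`. At `p = 3` on the inert-bad CM locus (ii) holds for a different reason —
`3 ∤ Tam(W)` for every CM curve with `3` unramified in the CM field
(`X12.not_three_dvd_tamagawaProduct_of_hasCM_of_not_cmRamified_three`) — and (iii) is the planner's
to restate (a guard-free twin of the law; cell bsd-cm ruling D70 after the referee's PASS on memo N21
v1.2, which removed the paper obstruction (GZ_η)@3 at `e = p − 1`).

THIS FILE (2/4): §0 `localTamagawaNumber_dvd_tamagawaProduct` and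
`padicValNat_localTamagawaNumber_eq_zero_of_hasCM_three` (`ord_3 c_3(W) = 0` for CM `W` with `3`
unramified in the CM field); §2 `valuation_coeff_one_le_of_lowerReading_of_ne_two` — x1b's one-sided
(C3_η) (file 126 §1) with `5 ≤ p` replaced by `p ≠ 2` + `ord_p c_p(W) = 0` — and
`missingLowerBoundAt_of_pairValuation_of_lowerReading_of_ne_two`, whose analytic input is the VALUE of
the law AT THE PAIR DATA (`v_p(coeff₁ L) = 2n + ord_p(q·Tam(W)/#W(ℚ)_tors²)` for `#Ш_an(W) = q`), so
that whatever guard-free statement of C-cc-1 the planner files instantiates it.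

HONEST STATUS (all four files). Everything is CONDITIONAL on displayed hypotheses: the law (C-cc-1) in
pair form, (C1_η), the reading `h74l` and the period datum `hper` are hypotheses, NOT claimed; the two
residual cruxes of the route stay open; nothing is booked; no label moves. With the three files the
`I₀*`-at-3 half of `InertBadAtThree` reads "kernel modulo C-cc-1@3 ∧ (C1_η)@3 ∧ named facts ∧ one
reading ∧ `hper`", exactly like the `p ≥ 5` node of record (`X12/ClassClosureO10Readings.lean`,
p402929); the `III/III*`-at-3 half is untouched (CONSTRUCTION).
[cite: Kobayashi2003, §4 (p. 8), Thm. 7.4 (p. 13), Thm. 9.3 (p. 26)] [cite: Miller2011LMS, §1, Def. 1.1]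
[cite: SilvermanAEC2009, VII.6.1 (Kodaira–Néron) and Cor. VII.6.2]
[cite: SilvermanATAEC1994, IV.9.4 (Tate's algorithm) and Table 4.1]
-/

set_option autoImplicit false
set_option linter.dupNamespace false

noncomputable section

open scoped Classical MatrixGroups ModularForm NumberField

open CongruenceSubgroup Field Function NumberField IsDedekindDomain IsDedekindDomain.HeightOneSpectrum
  WeierstrassCurve Rat.HeightOneSpectrum
open Literature.NumberTheory.EllipticCurves
open Literature.NumberTheory.EllipticCurves.ModularForms
open Literature.NumberTheory.EllipticCurves.Kobayashi2003
open Literature.NumberTheory.EllipticCurves.Rank1Residual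
open Literature.NumberTheory.EllipticCurves.Rank1Residual.Typed
open Literature.NumberTheory.GaloisRepresentations
open Literature.NumberTheory.GaloisCohomology
open Literature.NumberTheory.EllipticCurves.IwasawaAlgebra
open Summit.BirchSwinnertonDyer.Rank1Residual.Additive
open Summit.BirchSwinnertonDyer.Rank1Residual.Additive.LevelBridge
open Summit.BirchSwinnertonDyer.Rank1Residual
open Summit.BirchSwinnertonDyer.Rank1Residual.X12
open Summit.BirchSwinnertonDyer.Rank1Residual.X12.O10

-- Over `ℚ` two `ℚ`-algebra structures on a completion are in scope; the general-`K` statements must be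
-- met by the completion's own (the device of the x1b files 78, 107, 108, 118, 120–124).
attribute [local instance 10000] IsDedekindDomain.HeightOneSpectrum.instAlgebraAdicCompletion
  NumberField.Place.instAlgebraCompletion

namespace Summit.BirchSwinnertonDyer.BirchSwinnertonDyer.Theorems.InertBadOdd

variable (W : WeierstrassCurve ℚ) [W.IsElliptic] (p : ℕ) [hp : Fact p.Prime]

variable {p}

/-! ## §0 Tamagawa bookkeeping: `c_v ∣ Tam(W)`; `ord_3 c_3(W) = 0` on the CM locus with `3` unramified -/

omit hp in
/-- Each local Tamagawa number divides the Tamagawa product (`Tam(W)` is the `finprod` of the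
finitely supported family `c_v`). [cite: SilvermanAEC2009, VII.2 (remark after Prop. 2.1) and Cor. VII.6.2] -/
theorem localTamagawaNumber_dvd_tamagawaProduct (v : HeightOneSpectrum (𝓞 ℚ)) :
    (W.baseChange (v.adicCompletion ℚ)).localTamagawaNumber (v.adicCompletionIntegers ℚ) ∣
      W.tamagawaProduct := by
  have hfin : (Function.mulSupport fun v : HeightOneSpectrum (𝓞 ℚ) ↦
      (W.baseChange (v.adicCompletion ℚ)).localTamagawaNumber (v.adicCompletionIntegers ℚ)).Finite :=
    W.mulSupport_localTamagawaNumber_finite_holds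
  have hsub : (Function.mulSupport fun v : HeightOneSpectrum (𝓞 ℚ) ↦
      (W.baseChange (v.adicCompletion ℚ)).localTamagawaNumber (v.adicCompletionIntegers ℚ)) ⊆
      ↑(insert v hfin.toFinset) := fun u hu ↦ by
    rw [Finset.coe_insert]
    exact Set.mem_insert_of_mem _ (hfin.mem_toFinset.mpr hu)
  unfold WeierstrassCurve.tamagawaProduct
  rw [finprod_eq_prod_of_mulSupport_subset _ hsub]
  exact Finset.dvd_prod_of_mem _ (Finset.mem_insert_self v _)

omit hp in
/-- **`ord_3 c_3(W) = 0` for a CM curve `W/ℚ` with `3` unramified in the CM field** (in particular at an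
INERT bad `3`): `3 ∤ Tam(W)` (`X12.not_three_dvd_tamagawaProduct_of_hasCM_of_not_cmRamified_three`:
`j(W)` is a cube, so `Δ` is a cube and Tate's algorithm gives `c_v ∈ {1, 2, 4}` at every additive place),
and `c_3 ∣ Tam(W)`. [cite: SilvermanATAEC1994, IV.9.4 (Tate's algorithm) and Table 4.1] -/
theorem padicValNat_localTamagawaNumber_eq_zero_of_hasCM_three [W.IsGloballyMinimal] (hCM : W.HasCM)
    (hnr : ¬ CMRamified W 3) :
    padicValNat 3 ((W.baseChange (((primesEquiv (R := 𝓞 ℚ)).symm ⟨3, Nat.prime_three⟩).adicCompletion ℚ)).localTamagawaNumber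
      (((primesEquiv (R := 𝓞 ℚ)).symm ⟨3, Nat.prime_three⟩).adicCompletionIntegers ℚ)) = 0 := by
  refine padicValNat.eq_zero_of_not_dvd fun h ↦ ?_
  exact Summit.BirchSwinnertonDyer.Rank1Residual.X12.not_three_dvd_tamagawaProduct_of_hasCM_of_not_cmRamified_three
    W hCM hnr (h.trans (localTamagawaNumber_dvd_tamagawaProduct W _))

/-! ## §2 Pair level at an odd prime, LAW-AGNOSTIC: the lower half from the VALUE of the law at the pair -/

section Pair

variable [W.IsGloballyMinimal] {V : WeierstrassCurve ℚ} [V.IsElliptic] [V.IsGloballyMinimal]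
  {C : VariableChange ℚ} {N : ℕ} [NeZero N] {f : CuspForm (Gamma0 N) 2} {ϖ : ℚ} {L : IwasawaAlgebra p}
  {P : W.toAffine.Point} {n : ℕ}

/-- **ONE-SIDED (C3_η) at any ODD `p`: `Sel_str(W/ℚ)[p^∞]` finite and
`v_p(coeff₁ L) ≤ ord_p #Sel_str(W/ℚ)[p^∞] + n + ord_p(Tam(W)/#W(ℚ)_tors²)`** — x1b's
`LevelBridge.valuation_coeff_one_le_of_lowerReading` (file 126 §1) with its hypothesis `5 ≤ p` replaced
by the two things it is used for: `p ≠ 2` and `ord_p c_p(W) = 0` (`hv0`). Inputs: `hPT`, GZK, the LOWER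
odd-`η` reading `h74l` (hypothesis text), the pair data. Proof verbatim (file 118's `g(0) ≠ 0`, file 121's
`hnf`-free divisibility, gen 30's index, file 123 §0). CONDITIONAL; nothing asserted about the printed
theorems; nothing booked. [cite: Kobayashi2003, §4 (p. 8), Thm. 7.4 (p. 13), Thm. 9.3 (p. 26)]
[cite: GreenbergLNM1716, §4 Lemma 4.2 (p. 102)] [cite: MilneADT2006, Ch. I, Thm. 4.10] -/
theorem valuation_coeff_one_le_of_lowerReading_of_ne_two
    (hPT : poitouTate_selmerStructure_duality_real ℚ)
    (hGZK : rank_eq_analyticRank_of_analyticRank_le_one)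
    (h74l : ∀ (V : WeierstrassCurve ℚ) [V.IsElliptic] [V.IsGloballyMinimal] (C : VariableChange ℚ)
        {N : ℕ} [NeZero N] {f : CuspForm (Gamma0 N) 2},
        p ≠ 2 → C • W.quadraticTwist ((-1) ^ (p / 2) * p) = V →
        V.HasGoodReductionAtPrime p → V.frobeniusTrace p = 0 →
        QuadraticBranchPlusMainConjectureAt V p → IsNewformOf V f →
        ∀ (ϖ : ℚ), (if Even (p / 2) then (ϖ : ℝ) * V.realPeriodRat = plusPeriod f
            else (ϖ : ℝ) * V.imaginaryPeriodRat = minusPeriod f) →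
        ∀ (Lη : IwasawaAlgebra p), IsQuadraticBranchMinusLFunction f p ϖ Lη →
        ∀ (κ : ZpExtension ℚ p) (γ : Field.absoluteGaloisGroup ℚ),
          κ.IsCyclotomic → κ.IsTopGenerator γ → IsCyclotomicVariable p γ →
        ∀ (D : StrictSignedSelmerDualData W κ ℚ_[p] γ (-1)) (L' : IwasawaAlgebra p),
          Lη = PowerSeries.X * L' → D.charIdeal ≤ Ideal.span {L'})
    (hp2 : p ≠ 2)
    (hv0 : padicValNat p ((W.baseChange (((primesEquiv (R := 𝓞 ℚ)).symm ⟨p, hp.out⟩).adicCompletion ℚ)).localTamagawaNumber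
      (((primesEquiv (R := 𝓞 ℚ)).symm ⟨p, hp.out⟩).adicCompletionIntegers ℚ)) = 0)
    (hCV : C • W.quadraticTwist ((-1) ^ (p / 2) * p) = V)
    (hgood : V.HasGoodReductionAtPrime p) (hap : V.frobeniusTrace p = 0)
    (h1 : QuadraticBranchPlusMainConjectureAt V p) (hf : IsNewformOf V f)
    (hϖ : if Even (p / 2) then (ϖ : ℝ) * V.realPeriodRat = plusPeriod f
        else (ϖ : ℝ) * V.imaginaryPeriodRat = minusPeriod f)
    (hL : IsQuadraticBranchMinusLFunction f p ϖ L)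
    (htors : ∀ Q : (W.baseChange ℚ_[p]).toAffine.Point, p • Q = 0 → Q = 0)
    (hP : ¬ IsOfFinAddOrder P)
    (hgen : ∀ R : W.toAffine.Point, ∃ (k : ℤ) (T : W.toAffine.Point),
      IsOfFinAddOrder T ∧ R = k • P + T)
    (hdiv : ∃ Q : (W.baseChange ℚ_[p]).toAffine.Point, p ^ n • Q = W.toPadicPoint p P)
    (hndiv : ∀ Q : (W.baseChange ℚ_[p]).toAffine.Point, p ^ (n + 1) • Q ≠ W.toPadicPoint p P)
    (hr : W.analyticRank = 1) :
    Finite ↥(strictSelmerPInfty W p) ∧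
      ((PowerSeries.coeff 1 L : ℤ_[p]) : ℚ_[p]).valuation ≤
        (padicValNat p (Nat.card ↥(strictSelmerPInfty W p)) : ℤ) + n +
          padicValRat p ((W.tamagawaProduct : ℚ) / (W.torsionOrder : ℚ) ^ 2) := by
  -- adapted from Additive/QuadraticBranchLowerHalfOfReadings.lean (x1b file 126 §1), `hp5 ↦ hp2 + hv0`
  set v₀ := (Rat.HeightOneSpectrum.primesEquiv (R := 𝓞 ℚ)).symm ⟨p, hp.out⟩ with hv₀
  obtain ⟨-, hfin⟩ := hGZK W hr.le
  haveI : Finite W.sha := hfin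
  haveI hSha : Finite (AddCommGroup.primaryComponent W.sha p) := inferInstance
  obtain ⟨γ, hγ, hχ⟩ := CyclotomicZp.exists_isTopGenerator_zpExtension p
  have hκ := CyclotomicZp.isCyclotomic_zpExtension p
  have hγc : IsCyclotomicVariable p γ := ⟨1, IsOfFinOrder.one, by rw [mul_one]; exact hχ⟩
  obtain ⟨D⟩ := nonempty_strictSignedSelmerDualData W (CyclotomicZp.zpExtension p) ℚ_[p] (-1) hγ
  obtain ⟨L', hLL', hL'0⟩ := hL.exists_eq_X_mul
  have hle : D.charIdeal ≤ Ideal.span {L'} :=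
    h74l V C hp2 hCV hgood hap h1 hf ϖ hϖ L hL _ γ hκ hγ hγc D L' hLL'
  obtain ⟨g, hg⟩ := SubSelmerControlZero.exists_charIdeal_eq_span p D.X
  have hchar : D.charIdeal = Ideal.span {g} := by rw [StrictSignedSelmerDualData.charIdeal_def, hg]
  have hL'g : L' ∣ g := Ideal.span_singleton_le_span_singleton.mp (hchar ▸ hle)
  obtain ⟨S, hS⟩ := exists_finset_forall_not_mem_good W p
  have hpT : v₀ ∉ S.erase v₀ := fun h ↦ (Finset.mem_erase.mp h).1 rfl
  have hTmem : ∀ v : HeightOneSpectrum (𝓞 ℚ), v ≠ v₀ →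
      p ∣ (W.baseChange (v.adicCompletion ℚ)).localTamagawaNumber (v.adicCompletionIntegers ℚ) →
        v ∈ S.erase v₀ := by
    intro v hv hdvd
    refine Finset.mem_erase.mpr ⟨hv, ?_⟩
    by_contra hvS
    rw [W.localTamagawaNumber_eq_one_of_hasGoodReductionAt_holds v (hS v hvS).2] at hdvd
    exact hp.out.one_lt.ne' (Nat.dvd_one.mp hdvd)
  have hg0 : PowerSeries.constantCoeff g ≠ 0 := by
    obtain ⟨Q, hPQ⟩ := hdiv
    exact ((isTorsion_and_constantCoeff_ne_zero_of_quadraticTwist_signedPrime_rankOne W (CyclotomicZp.zpExtension p)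
      hp2 hκ C V hCV hgood hap hPT P hP hgen hPQ hndiv (S.erase v₀) hpT hTmem hγ D).2.2 g hchar).2
  have hL'le : ((PowerSeries.constantCoeff L' : ℤ_[p]) : ℚ_[p]).valuation ≤
      ((PowerSeries.constantCoeff g : ℤ_[p]) : ℚ_[p]).valuation := by
    obtain ⟨k, hk⟩ := hL'g
    have hgk : PowerSeries.constantCoeff g = PowerSeries.constantCoeff L' * PowerSeries.constantCoeff k := by
      rw [hk, map_mul]
    have hL'0' : PowerSeries.constantCoeff L' ≠ 0 := fun h ↦ hg0 (by rw [hgk, h, zero_mul])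
    have hk0 : PowerSeries.constantCoeff k ≠ 0 := fun h ↦ hg0 (by rw [hgk, h, mul_zero])
    have hL'Q : ((PowerSeries.constantCoeff L' : ℤ_[p]) : ℚ_[p]) ≠ 0 := PadicInt.coe_ne_zero.mpr hL'0'
    have hkQ : ((PowerSeries.constantCoeff k : ℤ_[p]) : ℚ_[p]) ≠ 0 := PadicInt.coe_ne_zero.mpr hk0
    rw [hgk, PadicInt.coe_mul, Padic.valuation_mul hL'Q hkQ]
    exact le_add_of_nonneg_right PadicInt.valuation_coe_nonneg
  have hSel := pow_constantCoeff_dvd_card_sha_mul_of_quadraticTwist_signedPrime_rankOne W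
    (CyclotomicZp.zpExtension p) hp2 hκ C V hCV hgood hap hPT P hP hgen hdiv hndiv (S.erase v₀) hpT hTmem hγ D
    hchar
  have hidx := StrictSha.strictSelmerIndexAt_holds W p P n hP hgen htors hdiv hndiv
  have hTamSum := sum_padicValNat_localTamagawaNumber_eq_padicValNat_tamagawaProduct W p (S.erase v₀) hpT
    hTmem hv0
  have htors0 := padicValNat_torsionOrder_eq_zero_of_noPTorsion W p htors
  have hSha0 : Nat.card (AddCommGroup.primaryComponent W.sha p) ≠ 0 := Nat.card_pos.ne'
  have hp0 : p ≠ 0 := hp.out.ne_zero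
  rw [Finset.prod_pow_eq_pow_sum, ← pow_add, hTamSum] at hSel
  have hval : (((PowerSeries.constantCoeff g : ℤ_[p]) : ℚ_[p]).valuation).toNat ≤
      padicValNat p (Nat.card (AddCommGroup.primaryComponent W.sha p)) + (2 * n + padicValNat p W.tamagawaProduct) := by
    have h := (padicValNat_dvd_iff_le (mul_ne_zero hSha0 (pow_ne_zero _ hp0))).mp hSel
    rwa [padicValNat.mul hSha0 (pow_ne_zero _ hp0), padicValNat.prime_pow] at h
  have hidxval : padicValNat p (Nat.card ↥(strictSelmerPInfty W p)) =
      n + padicValNat p (Nat.card (AddCommGroup.primaryComponent W.sha p)) := by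
    rw [hidx, padicValNat.mul (pow_ne_zero _ hp0) hSha0, padicValNat.prime_pow]
  refine ⟨Nat.finite_of_card_ne_zero (by rw [hidx]; exact mul_ne_zero (pow_ne_zero _ hp0) hSha0), ?_⟩
  have hTamQ : (W.tamagawaProduct : ℚ) ≠ 0 := by exact_mod_cast W.tamagawaProduct_pos_holds.ne'
  have htQ : (W.torsionOrder : ℚ) ≠ 0 := by exact_mod_cast W.torsionOrder_pos_holds.ne'
  have hrat : padicValRat p ((W.tamagawaProduct : ℚ) / (W.torsionOrder : ℚ) ^ 2) =
      (padicValNat p W.tamagawaProduct : ℤ) := by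
    rw [padicValRat.div hTamQ (pow_ne_zero 2 htQ), padicValRat.pow, padicValRat.of_nat, padicValRat.of_nat,
      htors0]
    simp
  have hv' : ((PowerSeries.constantCoeff g : ℤ_[p]) : ℚ_[p]).valuation =
      ((((PowerSeries.constantCoeff g : ℤ_[p]) : ℚ_[p]).valuation).toNat : ℤ) :=
    (Int.toNat_of_nonneg (PadicInt.valuation_coe_nonneg)).symm
  rw [← hL'0, hrat, hidxval]
  push_cast
  have hval' : ((((PowerSeries.constantCoeff g : ℤ_[p]) : ℚ_[p]).valuation).toNat : ℤ) ≤
      (padicValNat p (Nat.card (AddCommGroup.primaryComponent W.sha p)) : ℤ) +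
        (2 * (n : ℤ) + (padicValNat p W.tamagawaProduct : ℤ)) := by exact_mod_cast hval
  rw [hv'] at hL'le
  linarith

/-- **The LOWER HALF `MissingLowerBoundAt W p` at any ODD `p` from the VALUE OF THE LAW AT THE PAIR**
(`hv2`: `v_p(coeff₁ L) = 2n + ord_p(q · Tam(W)/#W(ℚ)_tors²)` whenever `#Ш_an(W) = q` — the conclusion of
C-cc-1 / `QuadraticBranchMinusLeadingValuationAt W p 0` at the pair data, taken as a hypothesis so that
any guard-free restatement of the law instantiates it), (C1_η) at the twin, `hmod hGZ hGZK hPT`, the lower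
reading `h74l`, `p ≠ 2` and `ord_p c_p(W) = 0`. x1b's file 126 §2 verbatim otherwise. CONDITIONAL;
nothing booked. [cite: Miller2011LMS, §1 and Def. 1.1] [cite: Kobayashi2003, §4 (p. 8), Thm. 7.4 (p. 13)]
[cite: GrossZagier1986, Thm. I.(7.3) 2) (p. 231)] -/
theorem missingLowerBoundAt_of_pairValuation_of_lowerReading_of_ne_two
    (hmod : hasEntireLFunction_rat) (hGZ : GrossZagier1986_thm_I_7_3)
    (hGZK : rank_eq_analyticRank_of_analyticRank_le_one)
    (hPT : poitouTate_selmerStructure_duality_real ℚ)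
    (h74l : ∀ (V : WeierstrassCurve ℚ) [V.IsElliptic] [V.IsGloballyMinimal] (C : VariableChange ℚ)
        {N : ℕ} [NeZero N] {f : CuspForm (Gamma0 N) 2},
        p ≠ 2 → C • W.quadraticTwist ((-1) ^ (p / 2) * p) = V →
        V.HasGoodReductionAtPrime p → V.frobeniusTrace p = 0 →
        QuadraticBranchPlusMainConjectureAt V p → IsNewformOf V f →
        ∀ (ϖ : ℚ), (if Even (p / 2) then (ϖ : ℝ) * V.realPeriodRat = plusPeriod f
            else (ϖ : ℝ) * V.imaginaryPeriodRat = minusPeriod f) →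
        ∀ (Lη : IwasawaAlgebra p), IsQuadraticBranchMinusLFunction f p ϖ Lη →
        ∀ (κ : ZpExtension ℚ p) (γ : Field.absoluteGaloisGroup ℚ),
          κ.IsCyclotomic → κ.IsTopGenerator γ → IsCyclotomicVariable p γ →
        ∀ (D : StrictSignedSelmerDualData W κ ℚ_[p] γ (-1)) (L' : IwasawaAlgebra p),
          Lη = PowerSeries.X * L' → D.charIdeal ≤ Ideal.span {L'})
    (hv2 : ∀ q : ℚ, shaAn W = (q : ℂ) →
      ((PowerSeries.coeff 1 L : ℤ_[p]) : ℚ_[p]).valuation =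
        2 * (n : ℤ) + padicValRat p (q * W.tamagawaProduct / (W.torsionOrder : ℚ) ^ 2))
    (hp2 : p ≠ 2)
    (hv0 : padicValNat p ((W.baseChange (((primesEquiv (R := 𝓞 ℚ)).symm ⟨p, hp.out⟩).adicCompletion ℚ)).localTamagawaNumber
      (((primesEquiv (R := 𝓞 ℚ)).symm ⟨p, hp.out⟩).adicCompletionIntegers ℚ)) = 0)
    (hCV : C • W.quadraticTwist ((-1) ^ (p / 2) * p) = V)
    (hgood : V.HasGoodReductionAtPrime p) (hap : V.frobeniusTrace p = 0)
    (h1 : QuadraticBranchPlusMainConjectureAt V p) (hf : IsNewformOf V f)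
    (hϖ : if Even (p / 2) then (ϖ : ℝ) * V.realPeriodRat = plusPeriod f
        else (ϖ : ℝ) * V.imaginaryPeriodRat = minusPeriod f)
    (hL : IsQuadraticBranchMinusLFunction f p ϖ L)
    (htors : ∀ Q : (W.baseChange ℚ_[p]).toAffine.Point, p • Q = 0 → Q = 0)
    (hP : ¬ IsOfFinAddOrder P)
    (hgen : ∀ R : W.toAffine.Point, ∃ (k : ℤ) (T : W.toAffine.Point),
      IsOfFinAddOrder T ∧ R = k • P + T)
    (hdiv : ∃ Q : (W.baseChange ℚ_[p]).toAffine.Point, p ^ n • Q = W.toPadicPoint p P)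
    (hndiv : ∀ Q : (W.baseChange ℚ_[p]).toAffine.Point, p ^ (n + 1) • Q ≠ W.toPadicPoint p P)
    (hr : W.analyticRank = 1) : MissingLowerBoundAt W p := by
  -- adapted from Additive/QuadraticBranchLowerHalfOfReadings.lean (x1b file 126 §2)
  obtain ⟨-, hfin⟩ := hGZK W hr.le
  haveI : Finite W.sha := hfin
  obtain ⟨s, hs⟩ := Disegni2020.exists_rat_shaAn_eq_of_analyticRank_eq_one hGZ hGZK W hr
  have hs0 : s ≠ 0 := by
    rintro rfl
    exact AdditivePotMult.shaAn_ne_zero W hmod (by rw [hs, Rat.cast_zero])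
  have hc : (W.tamagawaProduct : ℚ) ≠ 0 := by exact_mod_cast W.tamagawaProduct_pos_holds.ne'
  have ht : (W.torsionOrder : ℚ) ≠ 0 := by exact_mod_cast W.torsionOrder_pos_holds.ne'
  have hct : (W.tamagawaProduct : ℚ) / (W.torsionOrder : ℚ) ^ 2 ≠ 0 :=
    div_ne_zero hc (pow_ne_zero 2 ht)
  have hv2' := hv2 s hs
  have hsplit : padicValRat p (s * W.tamagawaProduct / (W.torsionOrder : ℚ) ^ 2) =
      padicValRat p s + padicValRat p ((W.tamagawaProduct : ℚ) / (W.torsionOrder : ℚ) ^ 2) := by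
    rw [mul_div_assoc, padicValRat.mul hs0 hct]
  obtain ⟨-, hv3⟩ := valuation_coeff_one_le_of_lowerReading_of_ne_two W hPT hGZK h74l hp2 hv0 hCV hgood
    hap h1 hf hϖ hL htors hP hgen hdiv hndiv hr
  haveI : Finite (AddCommGroup.primaryComponent W.sha p) := inferInstance
  have hI := (StrictSha.strictSelmerIndexAt_holds W p).padicValNat_card_eq hP hgen htors hdiv hndiv
  refine ⟨s, hs, ?_⟩
  rw [WeierstrassCurve.shaOrder, ← padicValNat_card_addPrimaryComponent]
  rw [hI, Nat.cast_add] at hv3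
  rw [hsplit] at hv2'
  linarith

end Pair


end Summit.BirchSwinnertonDyer.BirchSwinnertonDyer.Theorems.InertBadOdd

end
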